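import Mathlib
import HarnessLib
import HarnessLib.Audit
import Summits.MatrixMultiplication.Statement
import Literature.Computability.AlgebraicComplexity.MatrixMultiplicationExponent
import Summits.MatrixMultiplication.MatrixMultiplication.Theorems.RectangularAlphaSplitMiddle
import Summits.MatrixMultiplication.MatrixMultiplication.Theorems.RectangularAlphaMonotoneMiddle
import Summits.MatrixMultiplication.MatrixMultiplication.Theorems.AsymptoticSpectrumOmegaGeTwo
import Summits.MatrixMultiplication.MatrixMultiplication.Theorems.AsymptoticRankCWOmegaGeTwo
import HarnessLib.Audit.Status.Attr

/-!
Route: RectangularAlpha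

DORMANT since 2026-08-23T08:36:11Z (reconciler: no traction for 6 d (last activity statement-grounded at 2026-08-17T07:46:37Z); parked, not closed — `ledger route dormant route-MatrixMultiplication-RectangularAlpha --off` to reactivate) — unstaffed, not closed; items shared with open routes are served there. `ledger route dormant <id> --off` reactivates.

# Route RectangularAlpha — Dual exponent alpha = 1 (omega(1,a,1) = 2 for all a < 1) as an
alpha-milestone ladder for omega = 2

X_D (dual exponent α = 1): for every a < 1, multiplying an n × ⌈n^a⌉ matrix by an ⌈n^a⌉ × n matrix
has bilinear
complexity n^{2+o(1)} — ∀ a < 1, ∀ ε > 0, R(⟨n,⌈n^a⌉,n⟩) = O(n^{2+ε}) over ℂ; equivalently ω(1,a,1)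
= 2 for all a < 1,
i.e. α := sup{a | ω(1,a,1) = 2} = 1 (record α ≥ 0.321334, VassilevskaWilliamsXuXuZhou2024 =
arXiv:2307.07970 p. 2).
X_D → ω(ℂ) = 2 is the route's deciding theorem `closes (hD : DThesis) : MatrixMultiplication`,
CRUX-ONLY since rev 6:
⟨n,n,n⟩ restricts to ⌈n^{1−a}⌉ middle blocks ⟨n,⌈n^a⌉,n⟩, so R(⟨n,n,n⟩) ≤ 2n^{1−a}·R(⟨n,⌈n^a⌉,n⟩) =
O(n^{3−a+ε}),
a ↑ 1 gives ω ≤ 2, and ω ≥ 2 by flattening; the splitting / middle-monotonicity / ω ≥ 2 bookkeeping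
is PROVED in
tree (Theorems/RectangularAlphaSplitMiddle, RectangularAlphaMonotoneMiddle,
AsymptoticSpectrumOmegaGeTwo) and
discharged inside the proof, so DThesis is the only hypothesis. X_D is equivalent to the summit (ω =
2 ⇒
ω(1,a,1) ≤ ω by middle monotonicity), so the route is an honest α-MILESTONE LADDER: the research
content is the
two rungs DAlphaOneThird (a = 1/3, inside the CW_q cap 0.625) and DAlphaTwoThirds (a = 2/3, beyond
it); proving a
rung is a publishable record and refuting one kills every positive route of the summit. No idea card
(survey
route of 2026-08-13; known-grade by two refuter audits).
Lean: `∀ a : ℝ, a < 1 → ∀ ε : ℝ, 0 < ε → (fun n : ℕ =>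
(Literature.Computability.AlgebraicComplexity.tensorRank
(Literature.Computability.AlgebraicComplexity.matMulTensor ℂ n ⌈(n : ℝ) ^ a⌉₊ n) : ℝ))
=O[Filter.atTop] fun n : ℕ => (n : ℝ) ^ (2 + ε)`

## Assembly
Pure bookkeeping, certified: the deciding theorem `closes (hD : DThesis) :
_root_.MatrixMultiplication` (80-line Lean
proof, rev 6: a := 1 − δ/2, ε := δ/2; n ≤ ⌈n^a⌉·⌈n^{1−a}⌉ via DMonotoneMiddle + DSplitMiddle,
⌈n^{1−a}⌉ ≤ 2n^{1−a},
IsBigO.mul + rpow_add ⇒ 2 + δ admissible; csInf_le + le_of_forall_pos_le_add; 2 ≤ ω from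
OmegaGeTwo), with the three
support facts obtained from the in-tree theorems rather than as hypotheses (crux-only rule). The
Assembly item is
literally the type of `closes`, so `theorem Assembly_holds : Assembly := closes` settles it. The
milestone cruxes are
CONSEQUENCES of the thesis (DThesis ⇒ DAlphaTwoThirds ⇒ DAlphaOneThird, the last step by
DMonotoneMiddle) and are
deliberately NOT prepended as decorative hypotheses of `closes` (refuter reviews 2026-08-15).

Rationale: WHY THIS LINE. Incremental laser-method route of PROBLEMS.md §3, re-parametrised so that progress is
a real number a ↑ 1
(ω(1,a,1) = 2) rather than ω ↓ 2: rectangular upper bounds have moved steadily — Coppersmith1997 α >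
0.294,
LeGallUrrutia2018 = arXiv:1708.05622 α > 0.31389, VassilevskaWilliamsXuXuZhou2024 = arXiv:2307.07970
α ≥ 0.321334
(fourth power of CW_5, p. 37), while AlmanDuanVassilevskaWilliamsXuXuZhou2025 = arXiv:2404.16349
improves ω and
ω(1,k,1) but "we were not able to solve the constraint program for the value α" (p. 3) — and each
new a with
ω(1,a,1) = 2 is a closed, checkable statement of the same shape as X_D. Imported area: the laser
method with
asymmetric hashing (Salem–Spencer combinatorics, entropy optimisation over split distributions) for
the rung inside
the cap, and the asymptotic-spectrum theory of ChristandlLeGallLysikovZuiddam2025 = arXiv:2003.03019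
as the map of
where NOT to dig (every asymptotic CW_q-method certifies α ≤ 0.625 only; proved in tree as
`Literature.Barriers.MatrixMultiplication.RectangularBarrier_holds`), so the rung a = 2/3 and the
thesis need a
carrier outside the CW_q family — the last stretch is shared with routes AsymptoticRankCW /
AsymptoticSpectrum and
with the small-cw programme (R̃(cw_2) < 3.931, AlmanLi2026 = arXiv:2605.21738 Thm 1.3). What the
line adds over the
negatives index (4 refuted STPP/design statements, none rectangular) and prior routes: fact-free
raw-rank rungs on
both sides of the catalogued cap plus a certified, crux-only α ⇒ ω deciding theorem other cards
reuse
(ThinBlockAlpha wants DAlphaOneThird).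

RANKED CRUXES. #0 DThesis (crux) — X_D itself — dual exponent α = 1: for every a < 1 and ε > 0,
R(⟨n,⌈n^a⌉,n⟩) = O(n^{2+ε}) over ℂ (ω(1,a,1) = 2 for all a < 1); the single hypothesis of `closes`,
auto-badged crux by the gate (conjecture-grade: equivalent to ω(ℂ) = 2). [difficulty: open-problem]
(why it might fail: Equivalent to omega(C) = 2 itself; every bound since 1987 comes from a fixed
CW_q carrier, which certifies alpha <= 0.625 only (arXiv:2003.03019 Thm 3.22) and never omega = 2
(irreversibility, arXiv:1812.06952 Thm 9); alpha = 1 needs carriers or methods nobody has.)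
[arXiv:2003.03019, arXiv:1812.06952, arXiv:2307.07970, ChristandlLeGallLysikovZuiddam2025,
ChristandlVranaZuiddam2021]
#2 DAlphaOneThird (crux) — the next rung: ω(1,1/3,1) = 2 over ℂ, i.e. for every ε > 0,
R(⟨n,⌈n^{1/3}⌉,n⟩) = O(n^{2+ε}); above the record α ≥ 0.321334 and inside the CW_q cap 0.625, so
reachable in principle by the existing method; a proof is a publishable improvement of α (the one
crux provers should be staffed on). [difficulty: open-problem] (why it might fail: Record alpha >=
0.321334 is the 4th power of CW_5 (arXiv:2307.07970 p.37: the 8th power was already too slow to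
optimise); arXiv:2404.16349 could not solve its alpha program at all (p.3); per-power gains shrink
(0.31389 -> 0.321334 in six years) and may saturate below 1/3.) [arXiv:2307.07970, arXiv:2404.16349,
arXiv:1708.05622, arXiv:2003.03019, VassilevskaWilliamsXuXuZhou2024, LeGallUrrutia2018]
#3 DAlphaTwoThirds (crux) — the first rung beyond the Coppersmith–Winograd cap: ω(1,2/3,1) = 2 over
ℂ, i.e. for every ε > 0, R(⟨n,⌈n^{2/3}⌉,n⟩) = O(n^{2+ε}); since 2/3 > 0.625 no asymptotic
CW_q-method certifies it, so a proof must exhibit a new intermediate tensor (adequate functionals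
nearly flat on it, yet powers restricting to thin matrix products at cubic rate) or a method outside
`IsTMethodBound`; by ω + ωα/2 ≤ 3 (CLLZ Rem 3.23) it forces ω ≤ 2.25. Implies DAlphaOneThird given
DMonotoneMiddle. [difficulty: open-problem] (why it might fail: 2/3 > 0.625 >= cap of every
asymptotic CW_q-method, q >= 2 (arXiv:2003.03019 Thm 3.22; proved in tree:
RectangularBarrier_holds): needs a new carrier restricting to thin products at cubic rate, none
known (cw_q would need asymptotic rank q+1, open since 1990); forces omega <= 2.25 vs record
2.3713.) [arXiv:2003.03019, arXiv:1810.08671, arXiv:1812.06952, arXiv:2404.16349, arXiv:2605.21738,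
ChristandlLeGallLysikovZuiddam2025, AlmanLi2026]
#9 DSplitMiddle (support) — splitting the middle dimension over any field: R(⟨n, m·k, n⟩) ≤ k ·
R(⟨n, m, n⟩) (direct sum of k block copies; rank subadditive). PROVED in tree with this exact
signature: `Literature.CplxAlg.tensorRank_matMulTensor_split_middle_sig`
(Theorems/RectangularAlphaSplitMiddle.lean, p3481); used inside `closes`; a prover closes the item
by the one-liner `theorem DSplitMiddle_holds : DSplitMiddle :=
Literature.CplxAlg.tensorRank_matMulTensor_split_middle_sig`. [difficulty: provable-now]
[Blaser2013, BurgisserClausenShokrollahi1997]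
#9 DMonotoneMiddle (support) — monotonicity in the middle dimension over any field: m ≤ m′ →
R(⟨n,m,n⟩) ≤ R(⟨n,m′,n⟩) (zero-padding). PROVED in tree with this exact signature:
`Literature.CplxAlg.tensorRank_matMulTensor_monotone_middle`
(Theorems/RectangularAlphaMonotoneMiddle.lean, p3469); used inside `closes`; one-liner close as
above. [difficulty: provable-now] [Blaser2013, BurgisserClausenShokrollahi1997]
#9 OmegaGeTwo (support) — lower frame shared by all positive routes: admissibleExponents ℂ is
bounded below and 2 ≤ ω(ℂ) (flattening bound R(⟨n,n,n⟩) ≥ n²). PROVED in tree with this exact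
signature: `Literature.CplxAlg.omega_ge_two` (Theorems/AsymptoticSpectrumOmegaGeTwo.lean); used
inside `closes`; shared with route AsymptoticSpectrum; one-liner close as above. [difficulty:
provable-now] [Blaser2013, BurgisserClausenShokrollahi1997]

TWO-LAYER PLAN. Foreseen only: once a concrete constraint-program certificate for κ = 1/3 exists,
DAlphaOneThird ⇐ (a CW_5^{⊗4 or 8}
laser certificate `⟨M⟩ ⊗ CW_5^{⊗N} ⊵ ⟨t⟩ ⊗ ⟨m, ⌈m^{1/3}⌉, m⟩` as a degeneration statement) → (the
standard bridge
degeneration ⇒ rank bound, tree `omega_le_of_forall_polyDegeneratesTo`-style, rectangular version) →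
DAlphaOneThird;
k = 2, depth 1. Nothing filed now.

KILL CRITERIA. A proof that α < 1 — a spectral point / adequate functional F with F(⟨n,⌈n^a⌉,n⟩) ≥
n^{2+η} for some a < 1, η > 0 —
refutes DThesis and ω = 2 at once (close refuted:DThesis; it kills every positive route of the
summit).
¬DAlphaOneThird or ¬DAlphaTwoThirds (ω(1,a,1) > 2 for a single a < 1) has the same effect, since
either implies
ω > 2. A barrier theorem covering ALL carriers of bounded format for a > a₀ (not only CW_q) demotes
the route to
"incremental only": close as exhausted if a₀ < 0.7, keep rung #2 as a stand-alone record target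
otherwise.
Proved elsewhere: ω = 2 by any other route moots everything here (DThesis follows by middle
monotonicity).

NOT DECOMPOSED YET. Which hashing / asymmetry scheme reaches a = 1/3 (a layer-2 split of
DAlphaOneThird only after a concrete
constraint-program certificate exists); the rungs between 0.34 and 0.62; the carrier search behind
DAlphaTwoThirds
(stable or growing tensors, small cw_q with improved asymptotic rank, STPP families — the latter
constrained by the
group-theoretic barrier entries); the trivial implication web DThesis ⇒ DAlphaTwoThirds ⇒
DAlphaOneThird (checked
sorry-free by refuters, not filed as items: zero reduction content); the definitions omegaRect /
dualExponentAlpha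
(Literature RectangularExponent.lean) are deliberately not used — items stay in fact-free raw rank
form.

CHEAPEST FALSIFIER. Nothing cheap kills the line: every item is an upper-bound statement whose
negation is an ω > 2-type superquadratic
lower bound for a thin format, and linear rank methods (flattenings, Koszul/Young flattenings)
certify at most
6n² − 4 (Literature.Barriers.MatrixMultiplication.LinearRankMethodBarrier, proved). The cheapest
INFORMATIVE check is
numerical and bears on rung #2 only: re-solve the published CW_5 constraint program
(arXiv:2307.07970 §8, code on
osf.io) at κ = 1/3 for the 8th power — a bound ω(1,1/3,1) ≤ 2 + 10⁻⁴ that keeps shrinking with the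
power supports
"reachable by current technology"; a plateau bounded away from 2 across powers moves rung #2 outside
the CW_5
programme (not a refutation). Not run (compute-free hub; no kit job filed by this repair unit; tree
table
advxxz2025Table gives ω(1,1/3,1) ≤ 2.000520 by convex interpolation, refuter addendum 2026-08-15).

NUMBERS. α ≥ 0.321334 and ω ≤ 2.371552 from CW_5^{⊗4} (arXiv:2307.07970 p. 37); ω < 2.371339
(arXiv:2404.16349); α > 0.31389
(arXiv:1708.05622); α > 0.294 (Coppersmith1997); CW_q-method cap on certifiable α: 0.625 for all q ≥
2 (arXiv:2003.03019
v1 §1.3.1; exact 3 − (3/2)log₂3 = 0.62256 at q = 2, tree RectangularBarrier docstring); ω + ωα/2 ≤ 3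
(CLLZ Rem 3.23) so
α ≥ 1/3 ⇒ ω ≤ 18/7 ≈ 2.571 and α ≥ 2/3 ⇒ ω ≤ 2.25; R̃(cw_2) < 3.931 (arXiv:2605.21738 Thm 1.3).

DEFINITION REQUESTS. None: all items are stated over `tensorRank` / `matMulTensor` /
`admissibleExponents` / `omega` of
Literature.Computability.AlgebraicComplexity.MatrixMultiplicationExponent; no cite facts wanted (the
cone is fact-free).

Novelty: Searches (2026-08-16, this repair; 2026-08-15 by the opener/refuters): `lit search "rectangular
matrix multiplication dual exponent alpha" --year-from 2023` (remote: arXiv 1, zbMATH 2, Crossref 20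
— on topic only arXiv:2307.07970, doi:10.1007/s00037-025-00264-9 = arXiv:2003.03019,
doi:10.1137/1.9781611977912.133 = Le Gall 2024 combination loss; OpenAlex/S2 HTTP 429); `lit search
"rectangular matrix multiplication" --source arxiv --year-from 2025` (5 hits:
low-bandwidth/MPC/output-sparse models, no exponent work); `lit search "matrix multiplication
exponent" --source arxiv --year-from 2025` (4: Kauers–Moosbauer–Wood structure in decompositions,
Schwartz–Zwecher trilinear aggregation, numerics — none on α); `lit search "laser method matrix
multiplication omega bound" --source zbmath --year-from 2025` (1: arXiv:2404.16349); `lit frontier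
MatrixMultiplication --since 2025` (40 newest descendants: doi:10.1090/bull/1880 asymptotic-spectra
survey, arXiv:2605.21738 asymptotic rank speedups revisited, arXiv:2601.21553 support = quantum
functionals, arXiv:2601.08119 asymptotic-rank census, arXiv:2602.05541 an approximate quantum O(N²
log N) claim irrelevant to R(⟨n,n,n⟩) — none improves α); `lit galaxy search "dual exponent of
matrix multiplication" --star all` (3 pdf hits, downstream applications) and `… "rectangular matrix
multiplication exponent" --star pdf` (4, applications); `lit read arXiv:2404.16349 --grep` (p. 3
L15: α program unsolved) and `lit read arXiv:2307.07970 --grep 0.3  [refs: 10.1007/s00037-025-00264-9, 10.1137/1.9781611977912.133, 10.1090/bull/1880, 2307.07970, 2003.03019, 2404.16349, 2605.21738, 2601.21553, 2601.08119, 2602.05541, 1708.05622, 1810.08671, doi:10.1007/s00037-025-00264-9, doi:10.1137/1.9781611977912.133, doi:10.1090/bull/1880, AlmanLi2026, VassilevskaWilliamsXuXuZhou2024, LeGallUrrutia2018, Coppersmith1997, AlmanDuanVassilevskaWilliamsXuXuZhou2025, Chri]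

Barriers (technique_class: laser-method, CW-tensor, rectangular-MM, dual-exponent): - technique_class: laser-method, CW-tensor, rectangular-MM, dual-exponent
- Literature.Barriers.MatrixMultiplication.RectangularBarrier: proved in tree
(`RectangularBarrier_holds`); DAlphaOneThird evades it numerically (1/3 < 0.625, inside what
asymptotic CW_q-methods may certify); DAlphaTwoThirds and DThesis do NOT evade it with any CW_q, q ≥
2 — the bet is a different intermediate tensor, which the entry does not obstruct (its bound is
trivial when max_F log₂F(⟨2,2,2^p⟩)·log R̃(T)/log F(T) ≤ max(2,1+p); the live candidate is the small
cw_q, R̃(cw_2) < 3.931 by AlmanLi2026 Thm 1.3, with R̃(cw_q) = q+1 giving even ω = 2, Rem. 4.4), or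
a method outside `IsTMethodBound` (growing carrier families, STPP families, direct identities for
thin formats).
- Literature.Barriers.MatrixMultiplication.IrreversibilityBarrier: applies in full to DThesis (α = 1
⇔ ω = 2): no single fixed irreversible carrier t (i(t) > 1) certifies it; it does not evade — the
bet is the catalogued evasions (families with i(t_k) → 1, or cw_2 with R̃(cw_2) = 3); for the two
rungs (a < 1) the operative quantitative form is the RectangularBarrier entry above.
- Literature.Barriers.MatrixMultiplication.UniversalMethodBarrier: proved in tree; CW_q via the
universal method cannot show ω < 2.16805; consistent with both rungs (α ≥ 1/3 ⇒ only ω ≤ 2.571, α ≥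
2/3 ⇒ ω ≤ 2.25 > 2.168) and subsumed for a < 1 by the CLLZ cap; for DThesis it bars CW_q entirely
(no evasion claimed; same bet as above).
- Literature.Barriers.Matri

Novelty grade: known — Refuter re-grade (route-review gen-2, 2026-08-15): KNOWN — same grade as gen-0 (18:16Z), now with the remote search gen-0 could not run. The line is the published dual-exponent programme (Coppersmith 1997 α>0.294; Le Gall–Urrutia 2018 α>0.31389; VXXZ 2024 arXiv:2307.07970 α≥0.321334; ADVXXZ 2025 arX (refuter refuter-rreview1-MatrixMultiplication-Rectangul-54038549-g2-0, 2026-08-15T18:43:36Z; prior: arXiv:2307.07970, arXiv:2404.16349, arXiv:1708.05622, arXiv:2003.03019, arXiv:1810.08671, arXiv:1812.06952, doi:10.1006/jcom.1997.0438, arXiv:2307.06535)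

History (route lifecycle, newest last):
- 2026-08-15T16:17:17Z · rev 4: restated Assembly (stmt-MatrixMultiplication-0605) — route-repair (schema): restate Assembly over item NAMES (was: inlined DThesis → MatrixMultiplication, the glue.extra-hypothesis finding; now literally the type (planner-rbadge-MatrixMultiplication-Rectangula-54038549-g2-0)
- 2026-08-15T16:17:17Z · rev 4: dropped DBarrierFreeCarrier — route-repair (schema): restate Assembly over item NAMES (was: inlined DThesis → MatrixMultiplication, the glue.extra-hypothesis finding; now literally the type (planner-rbadge-MatrixMultiplication-Rectangula-54038549-g2-0)
- 2026-08-16T04:11:15Z · AUTO-CRUX (backfill): DThesis — hypotheses of the deciding theorem that nothing in the route derives are cruxes (operator:999:1085951)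
- 2026-08-16T06:06:36Z · rev 7: restated Assembly (stmt-MatrixMultiplication-10490) — route-repair (rbadge g3, 2026-08-16): CRUX-ONLY deciding theorem — `closes (hD : DThesis) : _root_.MatrixMultiplication`, the three bookkeeping hypotheses DSpli (planner-rbadge-MatrixMultiplication-Rectangula-54038549-g3-0)
- 2026-08-23T08:36:11Z · DORMANT — reconciler: no traction for 6 d (last activity statement-grounded at 2026-08-17T07:46:37Z); parked, not closed — `ledger route dormant route-MatrixMultiplicatio (operator:999:3297505)

sub-problem: MatrixMultiplication · status: dormant · opened planner-MatrixMultiplication-Survey-0 2026-08-13T13:20:30Z · rev 7 · ledger route-MatrixMultiplication-RectangularAlpha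
GENERATED by the gate from the ledger (D-0016/17). Provers cite these decls: `theorem foo : Summit.MatrixMultiplication.MatrixMultiplication.Theses.RectangularAlpha.<Decl> := …` in Summits/MatrixMultiplication/MatrixMultiplication/Theorems/<Name>.lean.
-/

namespace Summit.MatrixMultiplication.MatrixMultiplication.Theses.RectangularAlpha

open scoped BigOperators Topology Manifold Classical MeasureTheory ProbabilityTheory Matrix InnerProductSpace ComplexConjugate ContinuousMap
open Filter Set Function TopologicalSpace MeasureTheory

attribute [summit_statement] _root_.MatrixMultiplication

/-- item stmt-MatrixMultiplication-0604 · crux (kind.auto-crux: conjecture-grade) · rank 0 · open · by planner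
why it might fail: Equivalent to omega(C) = 2 itself; every bound since 1987 comes from a fixed CW_q carrier, which certifies alpha <= 0.625 only (arXiv:2003.03019 Thm 3.22) and never omega = 2 (irreversibility, arXiv:1812.06952 Thm 9); alpha = 1 needs carriers or methods nobody has.
sources: arXiv:2003.03019, arXiv:1812.06952, arXiv:2307.07970, ChristandlLeGallLysikovZuiddam2025, ChristandlVranaZuiddam2021
X_D: dual exponent α = 1: for every a<1 and ε>0, R(<n,⌈n^a⌉,n>) = O(n^{2+ε}) over ℂ (ω(1,a,1) = 2
for all a < 1). -/
@[route_item "route-MatrixMultiplication-RectangularAlpha", crux]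
def DThesis : Prop :=
  ∀ a : ℝ, a < 1 → ∀ ε : ℝ, 0 < ε → (fun n : ℕ => (Literature.Computability.AlgebraicComplexity.tensorRank (Literature.Computability.AlgebraicComplexity.matMulTensor ℂ n ⌈(n : ℝ) ^ a⌉₊ n) : ℝ)) =O[Filter.atTop] fun n : ℕ => (n : ℝ) ^ (2 + ε)

/-- item stmt-MatrixMultiplication-0606 · crux · rank 2 · open · by planner
why it might fail: Record alpha >= 0.321334 is the 4th power of CW_5 (arXiv:2307.07970 p.37: the 8th power was already too slow to optimise); arXiv:2404.16349 could not solve its alpha program at all (p.3); per-power gains shrink (0.31389 -> 0.321334 in six years) and may saturate below 1/3.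
sources: arXiv:2307.07970, arXiv:2404.16349, arXiv:1708.05622, arXiv:2003.03019, VassilevskaWilliamsXuXuZhou2024, LeGallUrrutia2018
Next milestone for the dual exponent: ω(1,1/3,1) = 2, i.e. for every ε>0, R(<n,⌈n^{1/3}⌉,n>) =
O(n^{2+ε}) over ℂ (record α ≥ 0.321334, VassilevskaWilliamsXuXuZhou2024; CW_q barrier 0.6218,
ChristandlLeGallLysikovZuiddam2025). -/
@[route_item "route-MatrixMultiplication-RectangularAlpha"]
def DAlphaOneThird : Prop :=
  ∀ ε : ℝ, 0 < ε → (fun n : ℕ => (Literature.Computability.AlgebraicComplexity.tensorRank (Literature.Computability.AlgebraicComplexity.matMulTensor ℂ n ⌈(n : ℝ) ^ (1 / 3 : ℝ)⌉₊ n) : ℝ)) =O[Filter.atTop] fun n : ℕ => (n : ℝ) ^ (2 + ε)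

/-- item stmt-MatrixMultiplication-8538 · crux · rank 3 · open · by planner
why it might fail: 2/3 > 0.625 >= cap of every asymptotic CW_q-method, q >= 2 (arXiv:2003.03019 Thm 3.22; proved in tree: RectangularBarrier_holds): needs a new carrier restricting to thin products at cubic rate, none known (cw_q would need asymptotic rank q+1, open since 1990); forces omega <= 2.25 vs record 2.3713.
sources: arXiv:2003.03019, arXiv:1810.08671, arXiv:1812.06952, arXiv:2404.16349, arXiv:2605.21738, ChristandlLeGallLysikovZuiddam2025
[crux] ω_ℂ(1, 2/3, 1) = 2 in rank form — ∀ ε > 0, R(⟨n, ⌈n^{2/3}⌉, n⟩) = O(n^{2+ε}) over ℂ: the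
first rung beyond the Coppersmith–Winograd barrier. Since 2/3 > 0.625, no asymptotic CW_q-method (q
≥ 2) can certify it (CLLZ Thm 3.22; Lean
`Literature.Barriers.MatrixMultiplication.CLLZ2025_alpha_barrier_CW`), so a proof must EXHIBIT a new
intermediate tensor T (adequate functionals nearly flat on T, yet T^{⊗k} restricting to thin matrix
products at cubic rate) or a method outside `IsTMethodBound` (growing carrier families, STPP
families, direct border-rank identities); by ω + ωα/2 ≤ 3 (CLLZ Rem 3.23) it would give ω ≤ 2.25.
Implies DAlphaOneThird given DMonotoneMiddle (checked in Sketch.lean). [difficulty: open-problem]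
Why it might fail: 2/3 > 0.625 = cap of every CW_q-method (CLLZ Thm 3.22): needs a nearly reversible
carrier that still restricts to thin matrix products at cubic rate — none is known (cw_q would need
asymptotic rank q+1, open since 1990) — and it forces ω ≤ 2.25, far beyond the 2.3713 record.
Sources: arXiv:2003.03019, arXiv:1810.08671, arXiv:1812.06952, arXiv:2404.16349. -/
@[route_item "route-MatrixMultiplication-RectangularAlpha"]
def DAlphaTwoThirds : Prop :=
  ∀ ε : ℝ, 0 < ε → (fun n : ℕ => (Literature.Computability.AlgebraicComplexity.tensorRank (Literature.Computability.AlgebraicComplexity.matMulTensor ℂ n ⌈(n : ℝ) ^ (2 / 3 : ℝ)⌉₊ n) : ℝ)) =O[Filter.atTop] fun n : ℕ => (n : ℝ) ^ (2 + ε)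

/-- item stmt-MatrixMultiplication-0608 · support · rank 4 · open · by planner
sources: Blaser2013, BurgisserClausenShokrollahi1997
Splitting the middle dimension over any field: R(<n, m·k, n>) ≤ k · R(<n, m, n>) (the tensor
<n,mk,n> is a sum of k copies of <n,m,n> on disjoint middle blocks; rank is subadditive). -/
@[route_item "route-MatrixMultiplication-RectangularAlpha"]
def DSplitMiddle : Prop :=
  ∀ (K : Type) [Field K] (n m k : ℕ), Literature.Computability.AlgebraicComplexity.tensorRank (Literature.Computability.AlgebraicComplexity.matMulTensor K n (m * k) n) ≤ k * Literature.Computability.AlgebraicComplexity.tensorRank (Literature.Computability.AlgebraicComplexity.matMulTensor K n m n)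

/-- item stmt-MatrixMultiplication-0609 · support · rank 4 · open · by planner
sources: Blaser2013, BurgisserClausenShokrollahi1997
Monotonicity in the middle dimension over any field: m ≤ m′ → R(<n,m,n>) ≤ R(<n,m′,n>) (restriction
by zero-padding). -/
@[route_item "route-MatrixMultiplication-RectangularAlpha"]
def DMonotoneMiddle : Prop :=
  ∀ (K : Type) [Field K] (n m m' : ℕ), m ≤ m' → Literature.Computability.AlgebraicComplexity.tensorRank (Literature.Computability.AlgebraicComplexity.matMulTensor K n m n) ≤ Literature.Computability.AlgebraicComplexity.tensorRank (Literature.Computability.AlgebraicComplexity.matMulTensor K n m' n)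

/-- item stmt-MatrixMultiplication-0586 · support · rank 5 · closed · proved by Summit.MatrixMultiplication.MatrixMultiplication.Theorems.omegaGeTwo_proof @ cbdcc04c67d9 (prover) · by planner
sources: Blaser2013, BurgisserClausenShokrollahi1997
Lower frame shared by all positive routes: admissibleExponents ℂ is bounded below and 2 ≤ ω(ℂ), from
the flattening bound R(<n,n,n>) ≥ n^2 (Blaser2013 §5–6; BurgisserClausenShokrollahi1997 (15.?)
conciseness) and n^2 = O(n^β) ⇒ β ≥ 2. -/
@[route_item "route-MatrixMultiplication-RectangularAlpha"]
def OmegaGeTwo : Prop :=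
  BddBelow (Literature.Computability.AlgebraicComplexity.admissibleExponents ℂ) ∧ 2 ≤ Literature.Computability.AlgebraicComplexity.omega ℂ

/-- `OmegaGeTwo` holds: proved by `Summit.MatrixMultiplication.MatrixMultiplication.Theorems.omegaGeTwo_proof` @ cbdcc04c67d9. -/
theorem OmegaGeTwo_holds : OmegaGeTwo := _root_.Summit.MatrixMultiplication.MatrixMultiplication.Theorems.omegaGeTwo_proof

-- earlier Assembly (stmt-MatrixMultiplication-0605, replaced 2026-08-15T16:17:17Z -> stmt-MatrixMultiplication-10490): retired by None — (∀ a : ℝ, a < 1 → ∀ ε : ℝ, 0 < ε → (fun n : ℕ => (Literature.Computability.AlgebraicComplexity.tensorRank (Literature.Computability.AlgebraicComplexity.matMulTensor ℂ n ⌈(n : ℝ) ^ a⌉₊ n) : ℝ)) =O[Filter.atTop] fun n : ℕ => (n : ℝ) ^ (2 + ε)) → MatrixMultiplication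
-- earlier Assembly (stmt-MatrixMultiplication-10490, replaced 2026-08-16T06:06:36Z -> stmt-MatrixMultiplication-14691): retired by None — DThesis → DSplitMiddle → DMonotoneMiddle → OmegaGeTwo → _root_.MatrixMultiplication
/-- item stmt-MatrixMultiplication-14691 · assembly · rank 1 · open · by planner
[assembly] X_D → ω(ℂ) = 2 over the route items BY NAME: DThesis → MatrixMultiplication — literally
the type of the crux-only deciding theorem `closes` (rev 6: the splitting / middle-monotonicity / ω
≥ 2 bookkeeping is proved in tree and discharged inside its proof), so `theorem Assembly_holds :
Assembly := closes` settles it. [difficulty: provable-now] -/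
@[route_item "route-MatrixMultiplication-RectangularAlpha"]
def Assembly : Prop :=
  DThesis → _root_.MatrixMultiplication

/-! D-0027 §2.1 — DECIDING THEOREM (planner-authored via `route open/edit --closes-file`; by planner-rbadge-MatrixMultiplication-Rectangula-54038549-g3-0 2026-08-16T06:06:36Z):
its hypotheses are this route's items and its conclusion the sub-problem Statement (glue_lint), and it elaborates with this file. -/

@[closes "route-MatrixMultiplication-RectangularAlpha"] theorem closes (hD : DThesis) : _root_.MatrixMultiplication := by
  classical
  -- the three bookkeeping facts are PROVED in tree (Theorems/RectangularAlphaSplitMiddle,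
  -- RectangularAlphaMonotoneMiddle, AsymptoticSpectrumOmegaGeTwo) and discharged here, so the
  -- deciding theorem is crux-only (D-0027 §2.1, crux-only rule 2026-08-16): its one hypothesis is DThesis.
  have hS : DSplitMiddle := Literature.CplxAlg.tensorRank_matMulTensor_split_middle_sig
  have hM : DMonotoneMiddle := Literature.CplxAlg.tensorRank_matMulTensor_monotone_middle
  have hΩ : OmegaGeTwo := Literature.CplxAlg.omega_ge_two
  obtain ⟨hbdd, htwo⟩ := hΩ
  show Literature.Computability.AlgebraicComplexity.omega ℂ = 2
  refine le_antisymm ?_ htwo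
  refine le_of_forall_pos_le_add fun δ hδ => ?_
  refine csInf_le hbdd ?_
  -- goal: 2 + δ is an admissible exponent
  show (fun n : ℕ => (Literature.Computability.AlgebraicComplexity.tensorRank
      (Literature.Computability.AlgebraicComplexity.matMulTensor ℂ n n n) : ℝ)) =O[Filter.atTop]
      fun n : ℕ => (n : ℝ) ^ (2 + δ)
  set a : ℝ := 1 - δ / 2 with ha_def
  set ε : ℝ := δ / 2 with hε_def
  have ha : a < 1 := by rw [ha_def]; linarith
  have hε : 0 < ε := by rw [hε_def]; positivity
  have h1a : 0 < 1 - a := by linarith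
  have hO := hD a ha ε hε
  -- pointwise comparison R(⟨n,n,n⟩) ≤ 2 n^{1-a} · R(⟨n,⌈n^a⌉₊,n⟩) for n ≥ 1
  have h1 : (fun n : ℕ => (Literature.Computability.AlgebraicComplexity.tensorRank
      (Literature.Computability.AlgebraicComplexity.matMulTensor ℂ n n n) : ℝ)) =O[Filter.atTop]
      fun n : ℕ => (n : ℝ) ^ (1 - a) *
        (Literature.Computability.AlgebraicComplexity.tensorRank
          (Literature.Computability.AlgebraicComplexity.matMulTensor ℂ n ⌈(n : ℝ) ^ a⌉₊ n) : ℝ) := by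
    refine Asymptotics.IsBigO.of_bound 2 ?_
    filter_upwards [Filter.eventually_ge_atTop 1] with n hn
    have hn1 : (1 : ℝ) ≤ n := by exact_mod_cast hn
    have hn0 : (0 : ℝ) < n := by linarith
    set M : ℕ := ⌈(n : ℝ) ^ a⌉₊ with hM_def
    set k : ℕ := ⌈(n : ℝ) ^ (1 - a)⌉₊ with hk_def
    have hMk : n ≤ M * k := by
      have hreal : (n : ℝ) ≤ (M : ℝ) * (k : ℝ) := by
        have hsplit : (n : ℝ) = (n : ℝ) ^ a * (n : ℝ) ^ (1 - a) := by
          rw [← Real.rpow_add hn0]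
          norm_num
        rw [hsplit]
        exact mul_le_mul (Nat.le_ceil _) (Nat.le_ceil _) (Real.rpow_nonneg hn0.le _)
          (Nat.cast_nonneg _)
      exact_mod_cast hreal
    have hR : Literature.Computability.AlgebraicComplexity.tensorRank
        (Literature.Computability.AlgebraicComplexity.matMulTensor ℂ n n n) ≤
        k * Literature.Computability.AlgebraicComplexity.tensorRank
          (Literature.Computability.AlgebraicComplexity.matMulTensor ℂ n M n) :=
      (hM ℂ n n (M * k) hMk).trans (hS ℂ n M k)
    have hRreal : (Literature.Computability.AlgebraicComplexity.tensorRank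
        (Literature.Computability.AlgebraicComplexity.matMulTensor ℂ n n n) : ℝ) ≤
        (k : ℝ) * (Literature.Computability.AlgebraicComplexity.tensorRank
          (Literature.Computability.AlgebraicComplexity.matMulTensor ℂ n M n) : ℝ) := by
      exact_mod_cast hR
    have hk2 : (k : ℝ) ≤ 2 * (n : ℝ) ^ (1 - a) := by
      have hlt : (k : ℝ) < (n : ℝ) ^ (1 - a) + 1 := Nat.ceil_lt_add_one (Real.rpow_nonneg hn0.le _)
      have hone : (1 : ℝ) ≤ (n : ℝ) ^ (1 - a) := Real.one_le_rpow hn1 h1a.le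
      linarith
    have hRa0 : (0 : ℝ) ≤ (Literature.Computability.AlgebraicComplexity.tensorRank
          (Literature.Computability.AlgebraicComplexity.matMulTensor ℂ n M n) : ℝ) := Nat.cast_nonneg _
    have hpow0 : (0 : ℝ) ≤ (n : ℝ) ^ (1 - a) := Real.rpow_nonneg hn0.le _
    rw [Real.norm_of_nonneg (Nat.cast_nonneg _), Real.norm_of_nonneg (mul_nonneg hpow0 hRa0)]
    calc (Literature.Computability.AlgebraicComplexity.tensorRank
          (Literature.Computability.AlgebraicComplexity.matMulTensor ℂ n n n) : ℝ)
        ≤ (k : ℝ) * (Literature.Computability.AlgebraicComplexity.tensorRank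
          (Literature.Computability.AlgebraicComplexity.matMulTensor ℂ n M n) : ℝ) := hRreal
      _ ≤ (2 * (n : ℝ) ^ (1 - a)) * (Literature.Computability.AlgebraicComplexity.tensorRank
          (Literature.Computability.AlgebraicComplexity.matMulTensor ℂ n M n) : ℝ) :=
          mul_le_mul_of_nonneg_right hk2 hRa0
      _ = 2 * ((n : ℝ) ^ (1 - a) * (Literature.Computability.AlgebraicComplexity.tensorRank
          (Literature.Computability.AlgebraicComplexity.matMulTensor ℂ n M n) : ℝ)) := by ring
  have h2 : (fun n : ℕ => (n : ℝ) ^ (1 - a) *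
        (Literature.Computability.AlgebraicComplexity.tensorRank
          (Literature.Computability.AlgebraicComplexity.matMulTensor ℂ n ⌈(n : ℝ) ^ a⌉₊ n) : ℝ))
      =O[Filter.atTop] fun n : ℕ => (n : ℝ) ^ (1 - a) * (n : ℝ) ^ (2 + ε) :=
    (Asymptotics.isBigO_refl (fun n : ℕ => (n : ℝ) ^ (1 - a)) Filter.atTop).mul hO
  have h3 : (fun n : ℕ => (n : ℝ) ^ (1 - a) * (n : ℝ) ^ (2 + ε)) =ᶠ[Filter.atTop]
      fun n : ℕ => (n : ℝ) ^ (2 + δ) := by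
    filter_upwards [Filter.eventually_ge_atTop 1] with n hn
    have hn0 : (0 : ℝ) < n := by exact_mod_cast hn
    rw [← Real.rpow_add hn0]
    congr 1
    rw [ha_def, hε_def]
    ring
  exact (h1.trans h2).trans_eventuallyEq h3

end Summit.MatrixMultiplication.MatrixMultiplication.Theses.RectangularAlpha
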